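import Mathlib.NumberTheory.Chebyshev
import Mathlib.NumberTheory.SmoothNumbers
import Mathlib.NumberTheory.SumPrimeReciprocals
import Mathlib.Combinatorics.Pigeonhole
import Mathlib.Analysis.SpecialFunctions.Pow.Asymptotics
import Mathlib.Analysis.Complex.ExponentialBounds
import HarnessLib

/-!
# Covering an interval by one residue class per prime (Westzynthius–Erdős–Rankin, qualitative)

Topic `Literature/NumberTheory/Sieve`. Everything in this file is PROVED (Mathlib only).

The main result `Literature.NumberTheory.Sieve.exists_residueClasses_cover` is the qualitative "killing sieve" behind the
Westzynthius–Erdős–Rankin large-gap theorems, in the Chinese-remainder form used by Richards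
and Hensley–Richards: for every constant `N`, for all sufficiently large `y`, one can choose a
single residue class `c_q (mod q)` for each prime `q ≤ y` such that EVERY integer of
`{1, …, N·y}` lies in `c_q (mod q)` for some prime `q ≤ y`.  Equivalently (by the Chinese
remainder theorem) some run of `N·y` consecutive integers consists of numbers each divisible by
a prime `≤ y`, i.e. the Jacobsthal function of the primorial satisfies `j(y#) > N y` for large
`y`; this is the form "(*) Fix any constant `N > 0`. Then … there exist SEQUENCES OF `N log x`
CONSECUTIVE INTEGERS, such that each integer in the sequence is divisible by some "small" prime
`p₀ < log x`" printed by Richards (with `y` of the order `log x`), attributed there to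
Westzynthius (1931), Erdős (1935) and Rankin (1938), and transformed by the Chinese remainder
theorem into his (**) (a congruence class all of whose elements in `[-x/2, x/2]` are
divisible by small primes). [cite: Richards1974, §4.4 (*) and §4.5 (**)]

## Proof (Erdős's three-stage argument, only the qualitative strength)

Fix `N ≥ 1`, put `U = N y`, and choose a constant `z = z(N)` with
`∏_{q ≤ z} (1 - 1/q) ≤ 1/(64 N²)` (possible since `∑ 1/q` diverges, Mathlib's
`not_summable_one_div_on_primes`; `Literature.NumberTheory.Sieve.exists_prod_primesLE_one_sub_inv_le`).
1. *Medium primes* `z < q ≤ y/4` get the class `0`.  An integer of `[1, U]` not covered is either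
   `z`-smooth (at most `2^{z+1} √U` of them, Mathlib's `Nat.smoothNumbersUpTo_card_le`) or of
   the form `m·P` with `P > y/4` prime and `m < 4N` (at most `4N π(U)` of them)
   (`Literature.NumberTheory.Sieve.filter_noMediumPrimeFactor_subset`).
2. *Small primes* `q ≤ z` are used greedily: by pigeonhole some class modulo `q` contains at
   least a `1/q` fraction of the current survivors, so after all `q ≤ z` at most a
   `∏_{q ≤ z}(1 - 1/q)` fraction survives (`Literature.NumberTheory.Sieve.exists_classes_card_filter_le`).
3. *Large primes* `y/4 < q ≤ y` each remove one remaining survivor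
   (`Literature.NumberTheory.Sieve.exists_classes_of_card_le`); there are enough of them because
   `π(y) - π(y/4) ≥ y/(4 log y)` (Chebyshev's bounds, Mathlib) while the survivors number at most
   `2^{z+1}√(Ny) + 4N · π(Ny)/(64N²) ≤ y/(4 log y)` for large `y` (`π(Ny) ≤ 2Ny/log y`,
   Chebyshev).

## References

* I. Richards, *On the incompatibility of two conjectures concerning primes*, Bull. AMS 80
  (1974) 419–438, §4.4–4.5. [Richards1974]
* E. Westzynthius, Comm. Phys.-Math. Helsingfors 5 (1931); P. Erdős, Quart. J. Math. Oxford 6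
  (1935); R. A. Rankin, J. London Math. Soc. 13 (1938) 242–247 (the quantitative versions).
-/

open Finset Filter Real

namespace Literature.NumberTheory.Sieve

/-! ### Stage 2: the greedy sieve -/

/-- **Pigeonhole modulo `q`**: for a finite set `S ⊆ ℕ` and `q ≥ 1`, some residue class
`a (mod q)` contains at least `#S / q` elements of `S`. [folklore] -/
theorem exists_residueClass_card_ge (S : Finset ℕ) {q : ℕ} (hq : 0 < q) :
    ∃ a : ℕ, (#S : ℝ) / q ≤ #(S.filter fun i => i ≡ a [MOD q]) := by
  classical
  have hmaps : ∀ i ∈ S, i % q ∈ range q := fun i _ => mem_range.2 (Nat.mod_lt i hq)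
  have hne : (range q).Nonempty := ⟨0, mem_range.2 hq⟩
  have hb : (range q).card • ((#S : ℝ) / q) ≤ #S := by
    rw [card_range, nsmul_eq_mul, mul_div_cancel₀ _ (by exact_mod_cast hq.ne')]
  obtain ⟨a, ha, hle⟩ := exists_le_card_fiber_of_nsmul_le_card_of_maps_to hmaps hne hb
  refine ⟨a, hle.trans ?_⟩
  have hsub : (S.filter fun i => i % q = a) ⊆ S.filter fun i => i ≡ a [MOD q] := by
    intro i hi
    rw [mem_filter] at hi ⊢
    refine ⟨hi.1, ?_⟩
    show i % q = a % q
    rw [hi.2, Nat.mod_eq_of_lt (mem_range.1 ha)]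
  exact_mod_cast card_le_card hsub

/-- **The greedy sieve.** For a finite `S ⊆ ℕ` and a finite set `Q` of moduli `≥ 1`, one can
choose one residue class `c q (mod q)` for each `q ∈ Q` so that the elements of `S` lying in
none of the chosen classes number at most `#S · ∏_{q ∈ Q} (1 - 1/q)` (choose the classes one
modulus at a time, each time a class containing at least a `1/q` fraction of the current
survivors). [folklore] -/
theorem exists_classes_card_filter_le (S : Finset ℕ) (Q : Finset ℕ) (hQ : ∀ q ∈ Q, 0 < q) :
    ∃ c : ℕ → ℕ, (#(S.filter fun i => ∀ q ∈ Q, ¬ i ≡ c q [MOD q]) : ℝ) ≤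
      #S * ∏ q ∈ Q, (1 - (q : ℝ)⁻¹) := by
  classical
  induction Q using Finset.induction_on with
  | empty =>
    refine ⟨fun _ => 0, ?_⟩
    simp
  | insert q Q hq ih =>
    obtain ⟨c, hc⟩ := ih fun q' hq' => hQ q' (mem_insert_of_mem hq')
    have hq0 : 0 < q := hQ q (mem_insert_self q Q)
    set T := S.filter fun i => ∀ q' ∈ Q, ¬ i ≡ c q' [MOD q'] with hT
    obtain ⟨a, ha⟩ := exists_residueClass_card_ge T hq0
    refine ⟨Function.update c q a, ?_⟩
    have hset : (S.filter fun i => ∀ q' ∈ insert q Q, ¬ i ≡ Function.update c q a q' [MOD q']) =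
        T.filter fun i => ¬ i ≡ a [MOD q] := by
      ext i
      simp only [hT, mem_filter, forall_mem_insert, Function.update_self]
      constructor
      · rintro ⟨hi, h1, h2⟩
        refine ⟨⟨hi, fun q' hq' => ?_⟩, h1⟩
        have := h2 q' hq'
        rwa [Function.update_of_ne (ne_of_mem_of_not_mem hq' hq)] at this
      · rintro ⟨⟨hi, h2⟩, h1⟩
        refine ⟨hi, h1, fun q' hq' => ?_⟩
        rw [Function.update_of_ne (ne_of_mem_of_not_mem hq' hq)]
        exact h2 q' hq'
    rw [hset, prod_insert hq]
    have hsplit := card_filter_add_card_filter_not (s := T) (fun i => i ≡ a [MOD q])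
    have hcardT : (#(T.filter fun i => ¬ i ≡ a [MOD q]) : ℝ) =
        #T - #(T.filter fun i => i ≡ a [MOD q]) := by
      rw [eq_sub_iff_add_eq, add_comm]
      exact_mod_cast hsplit
    have hq1 : (1 : ℝ) ≤ q := by exact_mod_cast hq0
    have hfac : 0 ≤ 1 - (q : ℝ)⁻¹ := sub_nonneg.2 (inv_le_one_of_one_le₀ hq1)
    calc (#(T.filter fun i => ¬ i ≡ a [MOD q]) : ℝ)
        = #T - #(T.filter fun i => i ≡ a [MOD q]) := hcardT
      _ ≤ #T - #T / q := by linarith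
      _ = #T * (1 - (q : ℝ)⁻¹) := by ring
      _ ≤ (#S * ∏ q' ∈ Q, (1 - (q' : ℝ)⁻¹)) * (1 - (q : ℝ)⁻¹) :=
          mul_le_mul_of_nonneg_right hc hfac
      _ = #S * ((1 - (q : ℝ)⁻¹) * ∏ q' ∈ Q, (1 - (q' : ℝ)⁻¹)) := by ring

/-! ### Stage 3: one survivor per remaining modulus -/

/-- If there are at least as many moduli in `Q` as elements of `S`, one class per modulus
covers `S` (give each element of `S` its own modulus and take its class). [folklore] -/
theorem exists_classes_of_card_le (S : Finset ℕ) (Q : Finset ℕ) (h : #S ≤ #Q) :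
    ∃ c : ℕ → ℕ, ∀ i ∈ S, ∃ q ∈ Q, i ≡ c q [MOD q] := by
  classical
  induction S using Finset.induction_on generalizing Q with
  | empty => exact ⟨fun _ => 0, by simp⟩
  | insert i S hi ih =>
    rw [card_insert_of_notMem hi] at h
    obtain ⟨q₀, hq₀⟩ : Q.Nonempty := card_pos.1 (by omega)
    obtain ⟨c, hc⟩ := ih (Q.erase q₀) (by rw [card_erase_of_mem hq₀]; omega)
    refine ⟨Function.update c q₀ i, ?_⟩
    intro j hj
    rcases mem_insert.1 hj with rfl | hj
    · exact ⟨q₀, hq₀, by rw [Function.update_self]⟩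
    · obtain ⟨q, hq, hmod⟩ := hc j hj
      refine ⟨q, mem_of_mem_erase hq, ?_⟩
      rwa [Function.update_of_ne (ne_of_mem_erase hq)]

/-! ### Stage 1: survivors of the medium primes -/

/-- After removing from `[1, N·y]` the multiples of the primes `q` with `z < q ≤ y/4`, every
survivor is either `z`-smooth or of the form `m · P` with `P` prime and `m < 4N` (if `P > z` is
a prime factor then `P > y/4`, so the cofactor is `< Ny/(y/4) = 4N`). [folklore] -/
theorem filter_noMediumPrimeFactor_subset (N y z : ℕ) :
    ((Icc 1 (N * y)).filter fun i => ∀ q ∈ Finset.Ioc z (y / (4 : ℕ)), q.Prime → ¬ q ∣ i) ⊆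
      Nat.smoothNumbersUpTo (N * y) (z + 1) ∪
        ((range (4 * N)) ×ˢ Nat.primesLE (N * y)).image fun mp => mp.1 * mp.2 := by
  intro i hi
  rw [mem_filter, mem_Icc] at hi
  obtain ⟨⟨hi1, hiU⟩, hmed⟩ := hi
  by_cases hs : i ∈ Nat.smoothNumbers (z + 1)
  · exact mem_union_left _ (Nat.mem_smoothNumbersUpTo.2 ⟨hiU, hs⟩)
  · rw [Nat.mem_smoothNumbers'] at hs
    push Not at hs
    obtain ⟨P, hP, hPi, hPz⟩ := hs
    have hzP : z < P := by omega
    have h4P : y < 4 * P := by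
      by_contra h
      exact hmed P (Finset.mem_Ioc.2 ⟨hzP, by omega⟩) hP hPi
    refine mem_union_right _ (mem_image.2 ⟨(i / P, P), ?_, Nat.div_mul_cancel hPi⟩)
    refine mem_product.2 ⟨mem_range.2 ?_, Nat.mem_primesLE.2 ⟨?_, hP⟩⟩
    · -- `i / P < 4N` since `(i / P) · P = i ≤ N y < 4 N P`
      by_contra hge
      push Not at hge
      have h1 : 4 * N * P ≤ i / P * P := Nat.mul_le_mul_right P hge
      rw [Nat.div_mul_cancel hPi] at h1
      have h2 : N * y < N * (4 * P) := by
        rcases Nat.eq_zero_or_pos N with rfl | hN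
        · omega
        · exact Nat.mul_lt_mul_of_pos_left h4P hN
      nlinarith
    · exact (Nat.le_of_dvd (by omega) hPi).trans hiU

/-! ### The product `∏_{q ≤ z} (1 - 1/q)` tends to zero -/

/-- `∏_{q ≤ z, q prime} (1 - 1/q)` can be made as small as we please: it is at most
`exp(-∑_{q ≤ z} 1/q)` and `∑_p 1/p` diverges (Euler; Mathlib's `not_summable_one_div_on_primes`).
[folklore] -/
theorem exists_prod_primesLE_one_sub_inv_le {δ : ℝ} (hδ : 0 < δ) :
    ∃ z : ℕ, ∏ q ∈ Nat.primesLE z, (1 - (q : ℝ)⁻¹) ≤ δ := by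
  have hnonneg : ∀ n : ℕ, 0 ≤ Set.indicator {p : ℕ | p.Prime} (fun n : ℕ => (1 : ℝ) / n) n :=
    fun n => Set.indicator_nonneg (fun m _ => by positivity) n
  have htend := (not_summable_iff_tendsto_nat_atTop_of_nonneg hnonneg).1
    not_summable_one_div_on_primes
  obtain ⟨z, hz⟩ := (htend.eventually (eventually_ge_atTop (Real.log δ⁻¹))).exists
  refine ⟨z, ?_⟩
  -- the partial sum over `range z` is the sum of `1/q` over the primes `< z`
  have hsum : ∑ i ∈ range z, Set.indicator {p : ℕ | p.Prime} (fun n : ℕ => (1 : ℝ) / n) i =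
      ∑ q ∈ Nat.primesBelow z, (q : ℝ)⁻¹ := by
    rw [Nat.primesBelow, sum_filter]
    refine sum_congr rfl fun i _ => ?_
    by_cases h : i.Prime
    · rw [Set.indicator_of_mem (show i ∈ {p : ℕ | p.Prime} from h), if_pos h, one_div]
    · rw [Set.indicator_of_notMem (show i ∉ {p : ℕ | p.Prime} from h), if_neg h]
  rw [hsum] at hz
  have hle : ∑ q ∈ Nat.primesBelow z, (q : ℝ)⁻¹ ≤ ∑ q ∈ Nat.primesLE z, (q : ℝ)⁻¹ :=
    sum_le_sum_of_subset_of_nonneg (Nat.primesBelow_mono (Nat.le_succ z))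
      fun q _ _ => by positivity
  calc ∏ q ∈ Nat.primesLE z, (1 - (q : ℝ)⁻¹)
      ≤ ∏ q ∈ Nat.primesLE z, Real.exp (-(q : ℝ)⁻¹) := by
        refine prod_le_prod (fun q hq => ?_) fun q _ => Real.one_sub_le_exp_neg _
        have : (1 : ℝ) ≤ q := by exact_mod_cast (Nat.prime_of_mem_primesLE hq).one_le
        exact sub_nonneg.2 (inv_le_one_of_one_le₀ this)
    _ = Real.exp (-∑ q ∈ Nat.primesLE z, (q : ℝ)⁻¹) := by rw [← Real.exp_sum, sum_neg_distrib]
    _ ≤ Real.exp (-Real.log δ⁻¹) := Real.exp_le_exp.2 (by linarith)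
    _ = δ := by rw [Real.log_inv, neg_neg, Real.exp_log hδ]

/-! ### Prime-counting inputs (Chebyshev's bounds, from Mathlib) -/

/-- `log y / √y → 0`. [folklore] -/
theorem tendsto_log_div_sqrt_atTop : Tendsto (fun y : ℝ => Real.log y / √y) atTop (nhds 0) := by
  have h := (isLittleO_log_rpow_atTop (r := 1 / 2) one_half_pos).tendsto_div_nhds_zero
  refine h.congr' ?_
  filter_upwards [eventually_ge_atTop 0] with y hy
  rw [Real.sqrt_eq_rpow]

/-- `ϑ b - ϑ a ≤ (π(b) - π(a)) · log b` for `0 ≤ a ≤ b`: the primes in `(a, b]` each contribute at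
most `log b` to `ϑ`. [folklore] -/
theorem theta_sub_theta_le {a b : ℝ} (hab : a ≤ b) :
    Chebyshev.theta b - Chebyshev.theta a ≤
      ((Nat.primeCounting ⌊b⌋₊ : ℝ) - Nat.primeCounting ⌊a⌋₊) * Real.log b := by
  have hsub : Nat.primesLE ⌊a⌋₊ ⊆ Nat.primesLE ⌊b⌋₊ := Nat.primesLE_mono (Nat.floor_le_floor hab)
  rw [Chebyshev.theta_eq_sum_primesLE b, Chebyshev.theta_eq_sum_primesLE a,
    ← sum_sdiff hsub, add_sub_cancel_right]
  have hcard : (#(Nat.primesLE ⌊b⌋₊ \ Nat.primesLE ⌊a⌋₊) : ℝ) =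
      (Nat.primeCounting ⌊b⌋₊ : ℝ) - Nat.primeCounting ⌊a⌋₊ := by
    rw [card_sdiff_of_subset hsub, Nat.cast_sub (card_le_card hsub),
      Nat.primesLE_card_eq_primeCounting, Nat.primesLE_card_eq_primeCounting]
  rw [← hcard]
  have hb : ∀ p ∈ Nat.primesLE ⌊b⌋₊ \ Nat.primesLE ⌊a⌋₊, Real.log p ≤ Real.log b := by
    intro p hp
    have hp' := (mem_sdiff.1 hp).1
    have hp1 : (1 : ℝ) ≤ p := by exact_mod_cast (Nat.prime_of_mem_primesLE hp').one_le
    have hpb : (p : ℝ) ≤ b := by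
      have h1 : (p : ℝ) ≤ ⌊b⌋₊ := by exact_mod_cast Nat.le_of_mem_primesLE hp'
      have hfl : 0 < ⌊b⌋₊ :=
        lt_of_lt_of_le (Nat.prime_of_mem_primesLE hp').pos (Nat.le_of_mem_primesLE hp')
      have h0 : (0 : ℝ) ≤ b := zero_le_one.trans (Nat.floor_pos.1 hfl)
      exact h1.trans (Nat.floor_le h0)
    exact Real.log_le_log (by linarith) hpb
  calc ∑ p ∈ Nat.primesLE ⌊b⌋₊ \ Nat.primesLE ⌊a⌋₊, Real.log p
      ≤ ∑ _p ∈ Nat.primesLE ⌊b⌋₊ \ Nat.primesLE ⌊a⌋₊, Real.log b := sum_le_sum hb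
    _ = #(Nat.primesLE ⌊b⌋₊ \ Nat.primesLE ⌊a⌋₊) * Real.log b := by
        rw [sum_const, nsmul_eq_mul]

/-- **Primes in `(y/4, y]` (Chebyshev):** for all large `y`, `π(y) - π(y/4) ≥ y / (4 log y)`
(from Mathlib's `ϑ(y) ≥ (y-1) log 2 - log(y+2) - 2√y log y` and `ϑ(y/4) ≤ (log 4) y/4`).
[folklore] -/
theorem eventually_primeCounting_sub_quarter_ge :
    ∀ᶠ y : ℕ in atTop, (y : ℝ) / (4 * Real.log y) ≤
      (Nat.primeCounting y : ℝ) - Nat.primeCounting (y / 4) := by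
  -- the constant `κ = (log 2)/2 - 1/4 > 0.09`
  have hκ : (9 / 100 : ℝ) < Real.log 2 / 2 - 1 / 4 := by
    have := Real.log_two_gt_d9
    linarith
  have hev : ∀ᶠ y : ℝ in atTop, Real.log y / √y ≤ 9 / 500 :=
    (tendsto_order.1 tendsto_log_div_sqrt_atTop).2 _ (by norm_num) |>.mono fun y hy => hy.le
  have hevN := tendsto_natCast_atTop_atTop.eventually hev
  filter_upwards [hevN, eventually_ge_atTop 3] with y hy hy3
  have hy3' : (3 : ℝ) ≤ y := by exact_mod_cast hy3
  have hy0 : (0 : ℝ) < y := by linarith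
  have hlog1 : 1 ≤ Real.log y := by
    rw [← Real.log_exp 1]
    refine Real.log_le_log (Real.exp_pos 1) ?_
    have := Real.exp_one_lt_d9
    linarith
  have hlog0 : 0 < Real.log y := by linarith
  have hsqrt0 : 0 < √(y : ℝ) := Real.sqrt_pos.2 hy0
  have hsqrt1 : 1 ≤ √(y : ℝ) := Real.one_le_sqrt.2 (by linarith)
  -- Chebyshev: `ϑ(y) - ϑ(y/4) ≥ (y-1) log 2 - log(y+2) - 2 √y log y - (log 2)/2 · y`
  have hθy := Chebyshev.theta_ge' (x := (y : ℝ)) (by linarith)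
  have hθq : Chebyshev.theta ((y : ℝ) / 4) ≤ Real.log 2 / 2 * y := by
    have := Chebyshev.theta_le_log4_mul_x (x := (y : ℝ) / 4) (by positivity)
    have h4 : Real.log 4 = 2 * Real.log 2 := by
      rw [show (4 : ℝ) = 2 ^ 2 by norm_num, Real.log_pow]; ring
    rw [h4] at this
    linarith
  -- the small terms are `≤ 5 √y log y ≤ κ y`
  have hsmall : Real.log 2 + Real.log ((y : ℝ) + 2) + 2 * √(y : ℝ) * Real.log y ≤
      5 * (√(y : ℝ) * Real.log y) := by
    have h1 : Real.log 2 ≤ √(y : ℝ) * Real.log y := by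
      have : Real.log 2 ≤ Real.log y := Real.log_le_log two_pos (by linarith)
      nlinarith
    have h2 : Real.log ((y : ℝ) + 2) ≤ 2 * (√(y : ℝ) * Real.log y) := by
      have : Real.log ((y : ℝ) + 2) ≤ Real.log ((y : ℝ) ^ 2) :=
        Real.log_le_log (by linarith) (by nlinarith)
      rw [Real.log_pow] at this
      push_cast at this
      nlinarith
    linarith
  have hratio : √(y : ℝ) * Real.log y ≤ 9 / 500 * y := by
    have h := hy
    rw [div_le_iff₀ hsqrt0] at h
    calc √(y : ℝ) * Real.log y ≤ √(y : ℝ) * (9 / 500 * √(y : ℝ)) :=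
          mul_le_mul_of_nonneg_left h hsqrt0.le
      _ = 9 / 500 * (√(y : ℝ) * √(y : ℝ)) := by ring
      _ = 9 / 500 * y := by rw [Real.mul_self_sqrt hy0.le]
  have hdiff : (y : ℝ) / 4 ≤ Chebyshev.theta y - Chebyshev.theta ((y : ℝ) / 4) := by
    nlinarith
  -- compare with `(π(y) - π(y/4)) log y`
  have hθπ := theta_sub_theta_le (a := (y : ℝ) / 4) (b := y) (by linarith)
  have hfl : ⌊(y : ℝ) / 4⌋₊ = y / 4 := by
    rw [Nat.floor_div_ofNat, Nat.floor_natCast]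
  rw [Nat.floor_natCast, hfl] at hθπ
  rw [div_le_iff₀ (by positivity)]
  calc (y : ℝ) ≤ 4 * (Chebyshev.theta y - Chebyshev.theta ((y : ℝ) / 4)) := by linarith
    _ ≤ 4 * (((Nat.primeCounting y : ℝ) - Nat.primeCounting (y / 4)) * Real.log y) := by
        linarith
    _ = ((Nat.primeCounting y : ℝ) - Nat.primeCounting (y / 4)) * (4 * Real.log y) := by ring

/-- **Chebyshev's upper bound along multiples:** for `N ≥ 1` and all large `y`,
`π(N y) ≤ 2 N y / log y` (Mathlib's `π(x) ≤ (log 4 + ε) x / log x` eventually, with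
`log 4 < 2` and `log (N y) ≥ log y`). [folklore] -/
theorem eventually_primeCounting_mul_le {N : ℕ} (hN : 0 < N) :
    ∀ᶠ y : ℕ in atTop, (Nat.primeCounting (N * y) : ℝ) ≤ 2 * N * y / Real.log y := by
  have hε : 0 < 2 - Real.log 4 := by
    have h4 : Real.log 4 = 2 * Real.log 2 := by
      rw [show (4 : ℝ) = 2 ^ 2 by norm_num, Real.log_pow]; ring
    have := Real.log_two_lt_d9
    rw [h4]; linarith
  have hev := Chebyshev.eventually_primeCounting_le hε
  have htend : Tendsto (fun y : ℕ => ((N * y : ℕ) : ℝ)) atTop atTop :=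
    tendsto_natCast_atTop_atTop.comp
      (tendsto_atTop_mono (fun y => Nat.le_mul_of_pos_left y hN) tendsto_id)
  filter_upwards [htend.eventually hev, eventually_ge_atTop 2] with y hy hy2
  simp only [Nat.floor_natCast] at hy
  have hy2' : (2 : ℝ) ≤ y := by exact_mod_cast hy2
  have hN1 : (1 : ℝ) ≤ N := by exact_mod_cast hN
  have hlogy : 0 < Real.log y := Real.log_pos (by linarith)
  have hlogle : Real.log y ≤ Real.log ((N * y : ℕ) : ℝ) := by
    push_cast
    exact Real.log_le_log (by linarith) (by nlinarith)
  calc (Nat.primeCounting (N * y) : ℝ)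
      ≤ (Real.log 4 + (2 - Real.log 4)) * ((N * y : ℕ) : ℝ) / Real.log ((N * y : ℕ) : ℝ) := hy
    _ = 2 * N * y / Real.log ((N * y : ℕ) : ℝ) := by push_cast; ring
    _ ≤ 2 * N * y / Real.log y := by
        apply div_le_div_of_nonneg_left (by positivity) hlogy hlogle

/-! ### The covering theorem -/

/-- **Westzynthius–Erdős–Rankin, Chinese-remainder form (qualitative).** For every `N`, for all
sufficiently large `y`, there are residue classes `c q (mod q)`, one for each prime `q ≤ y`, which
together cover `{1, …, N·y}`: every `1 ≤ i ≤ N y` satisfies `i ≡ c q (mod q)` for some prime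
`q ≤ y`.  (Richards' (*): runs of `N log x` consecutive integers each divisible by a prime below
`log x`, for any fixed `N`; here with `y` in place of `log x`.) [cite: Richards1974, §4.4 (*)] -/
theorem exists_residueClasses_cover (N : ℕ) :
    ∀ᶠ y : ℕ in atTop, ∃ c : ℕ → ℕ,
      ∀ i ∈ Icc 1 (N * y), ∃ q : ℕ, q.Prime ∧ q ≤ y ∧ i ≡ c q [MOD q] := by
  classical
  rcases Nat.eq_zero_or_pos N with rfl | hN
  · exact Eventually.of_forall fun y => ⟨fun _ => 0, by simp⟩
  -- the constant `z = z(N)`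
  have hN' : (0 : ℝ) < N := by exact_mod_cast hN
  obtain ⟨z, hz⟩ := exists_prod_primesLE_one_sub_inv_le (δ := 1 / (64 * (N : ℝ) ^ 2))
    (by positivity)
  -- smooth numbers are negligible: `2^{z+1} √(N y) ≤ y / (8 log y)` for large `y`
  have hκ : (0 : ℝ) < 1 / (8 * 2 ^ (z + 1) * √(N : ℝ)) := by positivity
  have hev4 : ∀ᶠ y : ℕ in atTop, (2 : ℝ) ^ (z + 1) * √((N : ℝ) * y) ≤ y / (8 * Real.log y) := by
    have hev : ∀ᶠ y : ℝ in atTop, Real.log y / √y ≤ 1 / (8 * 2 ^ (z + 1) * √(N : ℝ)) :=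
      (tendsto_order.1 tendsto_log_div_sqrt_atTop).2 _ hκ |>.mono fun y hy => hy.le
    filter_upwards [tendsto_natCast_atTop_atTop.eventually hev, eventually_ge_atTop 2]
      with y hy hy2
    have hy2' : (2 : ℝ) ≤ y := by exact_mod_cast hy2
    have hy0 : (0 : ℝ) < y := by linarith
    have hlog : 0 < Real.log y := Real.log_pos (by linarith)
    have hsq : 0 < √(y : ℝ) := Real.sqrt_pos.2 hy0
    have hsqN : 0 < √(N : ℝ) := Real.sqrt_pos.2 hN'
    rw [div_le_iff₀ hsq, one_div, le_inv_mul_iff₀ (by positivity)] at hy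
    -- `hy : 8 · 2^{z+1} √N · log y ≤ √y`
    rw [Real.sqrt_mul hN'.le, le_div_iff₀ (by positivity)]
    calc (2 : ℝ) ^ (z + 1) * (√(N : ℝ) * √(y : ℝ)) * (8 * Real.log y)
        = (8 * 2 ^ (z + 1) * √(N : ℝ) * Real.log y) * √(y : ℝ) := by ring
      _ ≤ √(y : ℝ) * √(y : ℝ) := mul_le_mul_of_nonneg_right hy hsq.le
      _ = y := Real.mul_self_sqrt hy0.le
  filter_upwards [eventually_ge_atTop (4 * (z + 1)), eventually_primeCounting_mul_le hN,
    eventually_primeCounting_sub_quarter_ge, hev4] with y hy1 hy2 hy3 hy4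
  -- Stage 1: medium primes `z < q ≤ y/4` get the class `0`
  set U := N * y with hU
  set S₁ := (Icc 1 U).filter fun i => ∀ q ∈ Finset.Ioc z (y / (4 : ℕ)), q.Prime → ¬ q ∣ i with hS₁
  -- Stage 2: greedy on the small primes `q ≤ z`
  obtain ⟨cs, hcs⟩ := exists_classes_card_filter_le S₁ (Nat.primesLE z)
    fun q hq => (Nat.prime_of_mem_primesLE hq).pos
  set S₂ := S₁.filter fun i => ∀ q ∈ Nat.primesLE z, ¬ i ≡ cs q [MOD q] with hS₂
  -- Stage 3: the large primes `y/4 < q ≤ y`, one survivor each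
  set Ql := Nat.primesLE y \ Nat.primesLE (y / 4) with hQl
  have hsubQ : Nat.primesLE (y / 4) ⊆ Nat.primesLE y := Nat.primesLE_mono (Nat.div_le_self y 4)
  have hcardQl : (#Ql : ℝ) = (Nat.primeCounting y : ℝ) - Nat.primeCounting (y / 4) := by
    rw [hQl, card_sdiff_of_subset hsubQ, Nat.cast_sub (card_le_card hsubQ),
      Nat.primesLE_card_eq_primeCounting, Nat.primesLE_card_eq_primeCounting]
  -- counting: `#S₂ ≤ #Ql`
  have hy2r : (2 : ℝ) ≤ y := by exact_mod_cast (show 2 ≤ y by omega)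
  have hlogy : 0 < Real.log y := Real.log_pos (by linarith)
  have hprod0 : 0 ≤ ∏ q ∈ Nat.primesLE z, (1 - (q : ℝ)⁻¹) :=
    prod_nonneg fun q hq => sub_nonneg.2 (inv_le_one_of_one_le₀
      (by exact_mod_cast (Nat.prime_of_mem_primesLE hq).one_le))
  have hprod1 : ∏ q ∈ Nat.primesLE z, (1 - (q : ℝ)⁻¹) ≤ 1 :=
    prod_le_one (fun q hq => sub_nonneg.2 (inv_le_one_of_one_le₀
      (by exact_mod_cast (Nat.prime_of_mem_primesLE hq).one_le)))
      fun q hq => sub_le_self _ (by positivity)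
  have hA : (#(Nat.smoothNumbersUpTo U (z + 1)) : ℝ) ≤ 2 ^ (z + 1) * √((N : ℝ) * y) := by
    have h1 := Nat.smoothNumbersUpTo_card_le U (z + 1)
    have h2 : #(z + 1).primesBelow ≤ z + 1 :=
      (card_filter_le (range (z + 1)) Nat.Prime).trans_eq (card_range _)
    have h3 : 2 ^ #(z + 1).primesBelow * U.sqrt ≤ 2 ^ (z + 1) * U.sqrt :=
      Nat.mul_le_mul_right _ (Nat.pow_le_pow_right two_pos h2)
    have h4 : (U.sqrt : ℝ) ≤ √((N : ℝ) * y) := by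
      have := Real.nat_sqrt_le_real_sqrt (a := U)
      rw [hU] at this ⊢
      push_cast at this
      exact this
    calc (#(Nat.smoothNumbersUpTo U (z + 1)) : ℝ) ≤ ((2 ^ (z + 1) * U.sqrt : ℕ) : ℝ) := by
          exact_mod_cast h1.trans h3
      _ = 2 ^ (z + 1) * (U.sqrt : ℝ) := by push_cast; ring
      _ ≤ 2 ^ (z + 1) * √((N : ℝ) * y) := by gcongr
  have hB : (#(((range (4 * N)) ×ˢ Nat.primesLE U).image fun mp => mp.1 * mp.2) : ℝ) ≤
      4 * N * (2 * N * y / Real.log y) := by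
    calc (#(((range (4 * N)) ×ˢ Nat.primesLE U).image fun mp => mp.1 * mp.2) : ℝ)
        ≤ #((range (4 * N)) ×ˢ Nat.primesLE U) := by exact_mod_cast card_image_le
      _ = 4 * N * (Nat.primeCounting U : ℝ) := by
          rw [card_product, card_range, Nat.primesLE_card_eq_primeCounting]; push_cast; ring
      _ ≤ 4 * N * (2 * N * y / Real.log y) := by gcongr
  have hS₁card : (#S₁ : ℝ) ≤ 2 ^ (z + 1) * √((N : ℝ) * y) + 4 * N * (2 * N * y / Real.log y) := by
    have h := card_le_card (filter_noMediumPrimeFactor_subset N y z)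
    rw [← hU, ← hS₁] at h
    have h' := h.trans (card_union_le _ _)
    have h'' : (#S₁ : ℝ) ≤ (#(Nat.smoothNumbersUpTo U (z + 1)) : ℝ) +
        #(((range (4 * N)) ×ˢ Nat.primesLE U).image fun mp => mp.1 * mp.2) := by
      exact_mod_cast h'
    linarith
  have hS₂card : (#S₂ : ℝ) ≤ #Ql := by
    rw [hcardQl]
    refine le_trans ?_ hy3
    calc (#S₂ : ℝ) ≤ #S₁ * ∏ q ∈ Nat.primesLE z, (1 - (q : ℝ)⁻¹) := hcs
      _ ≤ (2 ^ (z + 1) * √((N : ℝ) * y) + 4 * N * (2 * N * y / Real.log y)) *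
            ∏ q ∈ Nat.primesLE z, (1 - (q : ℝ)⁻¹) :=
          mul_le_mul_of_nonneg_right hS₁card hprod0
      _ ≤ 2 ^ (z + 1) * √((N : ℝ) * y) * 1 +
            4 * N * (2 * N * y / Real.log y) * (1 / (64 * (N : ℝ) ^ 2)) := by
          rw [add_mul]
          gcongr
      _ = 2 ^ (z + 1) * √((N : ℝ) * y) + y / (8 * Real.log y) := by
          field_simp
          ring
      _ ≤ y / (8 * Real.log y) + y / (8 * Real.log y) := by linarith
      _ = (y : ℝ) / (4 * Real.log y) := by
          field_simp
          ring
  obtain ⟨cl, hcl⟩ := exists_classes_of_card_le S₂ Ql (by exact_mod_cast hS₂card)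
  -- assemble the classes
  refine ⟨fun q => if q ≤ z then cs q else if 4 * q ≤ y then 0 else cl q, fun i hi => ?_⟩
  by_cases h1 : i ∈ S₁
  · by_cases h2 : i ∈ S₂
    · -- a survivor of stages 1–2: covered by a large prime
      obtain ⟨q, hq, hmod⟩ := hcl i h2
      rw [hQl, Finset.mem_sdiff, Nat.mem_primesLE, Nat.mem_primesLE] at hq
      obtain ⟨⟨hqy, hqp⟩, hnot⟩ := hq
      have hq4 : ¬ 4 * q ≤ y := fun h => hnot ⟨(Nat.le_div_iff_mul_le (by norm_num)).2
        (by omega), hqp⟩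
      have hqz : ¬ q ≤ z := by omega
      refine ⟨q, hqp, hqy, ?_⟩
      simp only [hqz, hq4, if_false]
      exact hmod
    · -- removed at stage 2: covered by a small prime
      rw [hS₂, mem_filter] at h2
      push Not at h2
      obtain ⟨q, hq, hmod⟩ := h2 h1
      rw [Nat.mem_primesLE] at hq
      refine ⟨q, hq.2, by omega, ?_⟩
      simp only [hq.1, if_true]
      exact hmod
  · -- removed at stage 1: a multiple of a medium prime
    rw [hS₁, mem_filter] at h1
    push Not at h1
    obtain ⟨q, hq, hqp, hdvd⟩ := h1 hi
    rw [Finset.mem_Ioc] at hq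
    have hq4 : 4 * q ≤ y := by omega
    refine ⟨q, hqp, by omega, ?_⟩
    have hqz : ¬ q ≤ z := by omega
    simp only [hqz, hq4, if_false, if_true]
    exact (Nat.modEq_zero_iff_dvd.2 hdvd)

end Literature.NumberTheory.Sieve
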